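import Literature.Probability.Percolation.CoveringQuotientExploration
import Literature.Probability.Percolation.EnhancedClusterModification
import HarnessLib

/-!
# The exploration of the enhanced cluster as an abstract machine (Martineau–Severo 2019, §5)

Support file of the inline proof of `Literature.Probability.Percolation.MartineauSevero2019_cor22`
(Proposition 4.1, the coupling). Martineau–Severo (Ann. Probab. 47 (2019), §5) explore the enhanced
cluster `𝒞_o(ω, α)` of the quotient `ℋ` algorithmically: in Step `2K+1` the `ω`-edges meeting the
current set are queried one at a time ("take `e` to be the smallest such edge … declare `e` to be
`p`-explored"), and in Step `2K+2` every vertex `u` of the current set "whose `r`-ball is fully open"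
and whose bonus has not been attempted is `s`-explored; the same sequence of queries is answered
either by the coins of `ℋ` (and the marks) or by fresh coins of the cover `𝒢`.

This file is the `ℋ`-level bookkeeping of that exploration as a `TExplore.Machine`
(`CoveringQuotientExploration.lean`), for the enhanced cluster of `EnhancedCluster.lean` in the finite
volume `B_{L+r}(o)`; nothing probabilistic happens here:

* `Coupling.Query`, `Coupling.HState`, `Coupling.nq`, `Coupling.hstep`, `Coupling.machine` — the state
  (explored vertices `A`, queried edges `Qd` with their query data `src`, open queried edges `O`,
  bonus-attempted vertices `Y`), the next query (an unqueried edge of `ℋ` at an explored vertex of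
  `B_{L+r-1}(o)` first; else the bonus of an explored, un-attempted vertex `u` with `d(o,u) < L` all of
  whose ball edges `E(B_r(u))` are queried-open), the update (an open edge adds its far endpoint; a
  successful bonus adds the sphere `S_{r+1}(u)`), and the machine (an edge query reads `N` coins in
  some-mode, a bonus reads `N` coins in all-mode);
* structural invariants of the replayed state (`inv_stateOf`), monotonicity, and the **halting bound**
  (`nq_eq_none_of_length`, `nq_stateOf_bt_eq_none`: after `|E(B_{L+r+1}(o))| + |B_L(o)| + 1` steps
  the machine has halted, since every productive step enlarges `Qd` or `Y`);
* **correctness** relative to a pair `(ω, α)` answering the queries (`Consistent`): the explored set is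
  contained in `𝒞_o(ω, α)` (`A_subset_enhCluster`) and, once halted, is closed under the two rules at
  vertices of `B_{L-1}(o)`, so that "a vertex at distance `≥ L` was explored" is exactly the event
  `𝓔_L` (`reachState_iff_of_halted`, through `exists_far_of_closed`);
* a generic freshness criterion `TExplore.goodEnc_of_used` and the length of transcripts along a run.

## References

* S. Martineau, F. Severo, Ann. Probab. 47 (2019), §5 (Structure of the process; Steps `2K+1`,
  `2K+2`) [MartineauSevero2019].
-/

noncomputable section

namespace Literature.Probability.Percolation

open Literature.Barriers.CriticalPhenomena ProbeHistory
open scoped Classical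

/-! ### Two generic complements to `TExplore` -/

namespace TExplore

variable {St Qy W : Type*} {M : Machine St Qy} {enc : List Bool → Qy → Finset (Sym2 W)} {Gc : SimpleGraph W}

/-- **Freshness from a bookkeeping of used coins.** If `used b` absorbs every probe made along the
transcript `b` and never shrinks, and the wanted probe after `b` avoids `used b`, then the encoding is
good. (Port of the tree's `SlabTorus.goodEnc_of_used`.) [cite: MartineauSevero2019, §5 (Conditions 1–4)] -/
theorem goodEnc_of_used (used : List Bool → Finset (Sym2 W))
    (hsub : ∀ b q, M.nq (stateOf M b) = some q → (↑(enc b q) : Set (Sym2 W)) ⊆ Gc.edgeSet)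
    (hcard : ∀ b q, M.nq (stateOf M b) = some q → (enc b q).card = M.qsize q)
    (hgrow : ∀ b q a, M.nq (stateOf M b) = some q → enc b q ∪ used b ⊆ used (a :: b))
    (hdisj : ∀ b q, M.nq (stateOf M b) = some q → Disjoint (enc b q) (used b)) :
    GoodEnc M enc Gc := by
  have hsupp : ∀ (k : ℕ) (ω : BondConfig W),
      supp ((texpl M enc).hist k ω) ⊆ used (bt M ((texpl M enc).hist k ω)) := by
    intro k ω
    induction k with
    | zero => simp
    | succ k ih =>
      rw [Explorer.hist_succ]
      cases hD : (texpl M enc).next ((texpl M enc).hist k ω) with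
      | none =>
        rw [Explorer.step_of_none _ hD, supp_cons_none, bt_cons_none]
        exact ih
      | some D =>
        rw [Explorer.step_of_some _ hD, supp_cons_some, bt_cons_some]
        have hc := ((texpl_next_eq_some_iff M enc).1 hD).1
        change wanted M enc (bt M ((texpl M enc).hist k ω)) = some D at hc
        unfold wanted at hc
        cases hq : M.nq (stateOf M (bt M ((texpl M enc).hist k ω))) with
        | none => rw [hq] at hc; cases hc
        | some q =>
          rw [hq] at hc
          simp only [Option.map_some, Option.some.injEq] at hc
          subst hc
          exact (Finset.union_subset_union le_rfl ih).trans (hgrow _ q _ hq)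
  refine ⟨hsub, hcard, fun k ω D hc => ?_⟩
  change wanted M enc (bt M ((texpl M enc).hist k ω)) = some D at hc
  unfold wanted at hc
  cases hq : M.nq (stateOf M (bt M ((texpl M enc).hist k ω))) with
  | none => rw [hq] at hc; cases hc
  | some q =>
    rw [hq] at hc
    simp only [Option.map_some, Option.some.injEq] at hc
    subst hc
    exact Finset.disjoint_of_subset_right (hsupp k ω) (hdisj _ q hq)

/-- Along a run of a good encoding, as long as the machine has not halted, the transcript after `k`
steps has length `k`. [folklore] -/
theorem length_bt_hist (hE : GoodEnc M enc Gc) (k : ℕ) (ω : BondConfig W)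
    (h : M.nq (stateOf M (bt M ((texpl M enc).hist k ω))) ≠ none) :
    (bt M ((texpl M enc).hist k ω)).length = k := by
  induction k with
  | zero => simp
  | succ k ih =>
    have hrec := bt_hist_succ_eq hE k ω
    cases hq : M.nq (stateOf M (bt M ((texpl M enc).hist k ω))) with
    | none =>
      rw [hq] at hrec
      simp only at hrec
      rw [hrec] at h
      exact absurd hq h
    | some q =>
      rw [hq] at hrec
      simp only at hrec
      rw [hrec, List.length_cons, ih (by rw [hq]; simp)]

/-- The answer recorded for the live query, along a run of a good encoding. [folklore] -/
theorem bt_hist_succ_of_some (hE : GoodEnc M enc Gc) {k : ℕ} {ω : BondConfig W} {q : Qy}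
    (hq : M.nq (stateOf M (bt M ((texpl M enc).hist k ω))) = some q) :
    bt M ((texpl M enc).hist (k + 1) ω) =
      answer M q (enc (bt M ((texpl M enc).hist k ω)) q, obs ω (enc (bt M ((texpl M enc).hist k ω)) q)) ::
        bt M ((texpl M enc).hist k ω) := by
  have hrec := bt_hist_succ_eq hE k ω
  rw [hq] at hrec
  exact hrec

/-- No answer is recorded once halted. [folklore] -/
theorem bt_hist_succ_of_none (hE : GoodEnc M enc Gc) {k : ℕ} {ω : BondConfig W}
    (hq : M.nq (stateOf M (bt M ((texpl M enc).hist k ω))) = none) :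
    bt M ((texpl M enc).hist (k + 1) ω) = bt M ((texpl M enc).hist k ω) := by
  have hrec := bt_hist_succ_eq hE k ω
  rw [hq] at hrec
  exact hrec

end TExplore

/-! ### The `ℋ`-level machine of the coupling -/

namespace Coupling

variable {Q : Type*}

/-- A query: the edge `s(a, b)` of `ℋ` probed from its explored endpoint `a` ("`p`-exploration"), or the
bonus of the vertex `u` ("`s`-exploration"). [cite: MartineauSevero2019, §5 (Steps 2K+1, 2K+2)] -/
inductive Query (Q : Type*)
  | edge (a b : Q) : Query Q
  | bonus (u : Q) : Query Q

/-- The state of the exploration: explored vertices `A`, queried edges `Qd` with their query data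
`src`, queried edges found open `O`, vertices `Y` whose bonus was attempted.
[cite: MartineauSevero2019, §5 (C_{ℓ,n} and the p- and s-explored objects)] -/
structure HState (Q : Type*) where
  /-- explored vertices (the enhanced cluster found so far) -/
  A : Finset Q
  /-- queried edges of `ℋ` -/
  Qd : Finset (Sym2 Q)
  /-- queried edges found open -/
  O : Finset (Sym2 Q)
  /-- vertices whose bonus has been attempted -/
  Y : Finset Q
  /-- for a queried edge, the ordered pair (explored endpoint, far endpoint) it was queried as -/
  src : Sym2 Q → Q × Q

/-- The initial state: only the root is explored. [cite: MartineauSevero2019, §5 (Step 0)] -/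
def HState.init (o : Q) : HState Q := ⟨{o}, ∅, ∅, ∅, fun _ => (o, o)⟩

variable (H : SimpleGraph Q) [H.LocallyFinite] (o : Q) (r L : ℕ)

/-- The sphere `S_n(u) = {v : d(u,v) = n}` as a finset. [cite: MartineauSevero2019, §4 (S_r(x))] -/
def sphereF (u : Q) (n : ℕ) : Finset Q := (ballFin H u n).filter fun v => H.dist u v = n

/-- The ball `B_r(u)` is *explored-open* in the state `σ`: all edges of `E(B_r(u))` are queried-open.
[cite: MartineauSevero2019, §5 (Step 2K+2: "whose r-ball is fully open")] -/
def ballOpen (σ : HState Q) (u : Q) : Prop := ∀ e ∈ edgesInBallFin H u r, e ∈ σ.O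

/-- **The next query** (`none` = halt): an unqueried edge of `ℋ` at an explored vertex `a` with
`d(o,a) < L + r` if any (`p`-exploration first), else the bonus of an explored, un-attempted vertex
`u` with `d(o,u) < L` whose ball is explored-open. [cite: MartineauSevero2019, §5 (Steps 2K+1, 2K+2)] -/
def nq (σ : HState Q) : Option (Query Q) :=
  if h : ∃ q : Q × Q, q.1 ∈ σ.A ∧ H.Adj q.1 q.2 ∧ H.dist o q.1 < L + r ∧ s(q.1, q.2) ∉ σ.Qd then
    some (Query.edge h.choose.1 h.choose.2)
  else if h' : ∃ u : Q, u ∈ σ.A ∧ H.dist o u < L ∧ u ∉ σ.Y ∧ ballOpen H r σ u then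
    some (Query.bonus h'.choose)
  else none

/-- **One step**: record the query and, on a positive answer, add the far endpoint (edge query) or the
sphere `S_{r+1}(u)` (bonus). [cite: MartineauSevero2019, §5 (Steps 2K+1, 2K+2)] -/
def hstep (σ : HState Q) : Query Q → Bool → HState Q
  | Query.edge a b, ans =>
    { A := if ans then insert b σ.A else σ.A
      Qd := insert s(a, b) σ.Qd
      O := if ans then insert s(a, b) σ.O else σ.O
      Y := σ.Y
      src := Function.update σ.src s(a, b) (a, b) }
  | Query.bonus u, ans =>
    { A := if ans then σ.A ∪ sphereF H u (r + 1) else σ.A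
      Qd := σ.Qd
      O := σ.O
      Y := insert u σ.Y
      src := σ.src }

/-- **The machine**: an edge query reads `N` coins in some-mode (the `N` copies of an edge; open iff
some copy is), a bonus reads `N` coins in all-mode. [cite: MartineauSevero2019, §5 (the multigraph; s-exploration)] -/
def machine (N : ℕ) : TExplore.Machine (HState Q) (Query Q) where
  init := HState.init o
  nq := nq H o r L
  step := hstep H r
  qsize := fun _ => N
  allMode := fun q => match q with
    | Query.edge _ _ => false
    | Query.bonus _ => true

variable {H o r L}

/-! ### Specifications of the next query -/

/-- What an edge query guarantees. [cite: MartineauSevero2019, §5 (Step 2K+1)] -/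
theorem nq_edge_spec {σ : HState Q} {a b : Q} (h : nq H o r L σ = some (Query.edge a b)) :
    a ∈ σ.A ∧ H.Adj a b ∧ H.dist o a < L + r ∧ s(a, b) ∉ σ.Qd := by
  unfold nq at h
  split_ifs at h with h1 h2
  · simp only [Option.some.injEq, Query.edge.injEq] at h
    obtain ⟨rfl, rfl⟩ := h
    exact h1.choose_spec
  · simp at h

/-- What a bonus query guarantees: no edge query was available, and the vertex is explored, close to
the root, un-attempted, with explored-open ball. [cite: MartineauSevero2019, §5 (Step 2K+2)] -/
theorem nq_bonus_spec {σ : HState Q} {u : Q} (h : nq H o r L σ = some (Query.bonus u)) :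
    (¬ ∃ q : Q × Q, q.1 ∈ σ.A ∧ H.Adj q.1 q.2 ∧ H.dist o q.1 < L + r ∧ s(q.1, q.2) ∉ σ.Qd) ∧
      u ∈ σ.A ∧ H.dist o u < L ∧ u ∉ σ.Y ∧ ballOpen H r σ u := by
  unfold nq at h
  split_ifs at h with h1 h2
  · simp at h
  · simp only [Option.some.injEq, Query.bonus.injEq] at h
    subst h
    exact ⟨h1, h2.choose_spec⟩

/-- The machine halts iff every edge at an explored vertex of `B_{L+r-1}(o)` is queried and every
admissible explored-open vertex has had its bonus attempted. [cite: MartineauSevero2019, §5] -/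
theorem nq_eq_none_iff {σ : HState Q} :
    nq H o r L σ = none ↔
      (∀ a ∈ σ.A, ∀ b, H.Adj a b → H.dist o a < L + r → s(a, b) ∈ σ.Qd) ∧
      (∀ u ∈ σ.A, H.dist o u < L → ballOpen H r σ u → u ∈ σ.Y) := by
  unfold nq
  split_ifs with h1 h2
  · constructor
    · intro h; cases h
    · rintro ⟨hall, -⟩
      obtain ⟨⟨a, b⟩, ha, hab, hd, hQ⟩ := h1
      exact absurd (hall a ha b hab hd) hQ
  · constructor
    · intro h; cases h
    · rintro ⟨-, hall⟩
      obtain ⟨u, hu, hd, hY, hopen⟩ := h2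
      exact absurd (hall u hu hd hopen) hY
  · simp only [true_iff]
    exact ⟨fun a ha b hab hd => by_contra fun hQ => h1 ⟨(a, b), ha, hab, hd, hQ⟩,
      fun u hu hd hopen => by_contra fun hY => h2 ⟨u, hu, hd, hY, hopen⟩⟩

/-! ### The replayed state -/

variable {N : ℕ}

variable (H o r L N) in
/-- The replayed state of the coupling machine after a transcript. [cite: MartineauSevero2019, §5] -/
abbrev stateOf (b : List Bool) : HState Q := TExplore.stateOf (machine H o r L N) b

/-- Unfolding the replayed state on a cons. [folklore] -/
theorem stateOf_cons (a : Bool) (b : List Bool) :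
    stateOf H o r L N (a :: b) = (match nq H o r L (stateOf H o r L N b) with
      | none => stateOf H o r L N b
      | some q => hstep H r (stateOf H o r L N b) q a) := by
  cases hq : nq H o r L (stateOf H o r L N b) with
  | none =>
    have h' : (machine H o r L N).nq (TExplore.stateOf (machine H o r L N) b) = none := hq
    show TExplore.stateOf (machine H o r L N) (a :: b) = _
    rw [TExplore.stateOf_cons, h']
  | some q =>
    have h' : (machine H o r L N).nq (TExplore.stateOf (machine H o r L N) b) = some q := hq
    show TExplore.stateOf (machine H o r L N) (a :: b) = _
    rw [TExplore.stateOf_cons, h']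
    rfl

/-- Once halted, the replayed state is frozen. [folklore] -/
theorem stateOf_cons_of_none {b : List Bool} (h : nq H o r L (stateOf H o r L N b) = none) (a : Bool) :
    stateOf H o r L N (a :: b) = stateOf H o r L N b := by
  rw [stateOf_cons, h]

/-- A productive step. [folklore] -/
theorem stateOf_cons_of_some {b : List Bool} {q : Query Q} (h : nq H o r L (stateOf H o r L N b) = some q)
    (a : Bool) : stateOf H o r L N (a :: b) = hstep H r (stateOf H o r L N b) q a := by
  rw [stateOf_cons, h]

/-- The initial replayed state. [folklore] -/
@[simp] theorem stateOf_nil : stateOf H o r L N [] = HState.init o := rfl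

/-! ### The fields of `hstep` -/

/-- Explored vertices after an edge query. [folklore] -/
theorem mem_A_hstep_edge {σ : HState Q} {a c : Q} {ans : Bool} {v : Q} :
    v ∈ (hstep H r σ (Query.edge a c) ans).A ↔ v ∈ σ.A ∨ (ans = true ∧ v = c) := by
  cases ans <;> simp [hstep, or_comm]

/-- Queried edges after an edge query. [folklore] -/
theorem mem_Qd_hstep_edge {σ : HState Q} {a c : Q} {ans : Bool} {e : Sym2 Q} :
    e ∈ (hstep H r σ (Query.edge a c) ans).Qd ↔ e = s(a, c) ∨ e ∈ σ.Qd := by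
  simp [hstep]

/-- Open queried edges after an edge query. [folklore] -/
theorem mem_O_hstep_edge {σ : HState Q} {a c : Q} {ans : Bool} {e : Sym2 Q} :
    e ∈ (hstep H r σ (Query.edge a c) ans).O ↔ e ∈ σ.O ∨ (ans = true ∧ e = s(a, c)) := by
  cases ans <;> simp [hstep, or_comm]

/-- Attempted vertices after an edge query. [folklore] -/
theorem Y_hstep_edge {σ : HState Q} {a c : Q} {ans : Bool} : (hstep H r σ (Query.edge a c) ans).Y = σ.Y := rfl

/-- Query data after an edge query. [folklore] -/
theorem src_hstep_edge {σ : HState Q} {a c : Q} {ans : Bool} :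
    (hstep H r σ (Query.edge a c) ans).src = Function.update σ.src s(a, c) (a, c) := rfl

/-- Explored vertices after a bonus. [folklore] -/
theorem mem_A_hstep_bonus {σ : HState Q} {u : Q} {ans : Bool} {v : Q} :
    v ∈ (hstep H r σ (Query.bonus u) ans).A ↔ v ∈ σ.A ∨ (ans = true ∧ v ∈ sphereF H u (r + 1)) := by
  cases ans <;> simp [hstep]

/-- Queried edges after a bonus. [folklore] -/
theorem Qd_hstep_bonus {σ : HState Q} {u : Q} {ans : Bool} : (hstep H r σ (Query.bonus u) ans).Qd = σ.Qd := rfl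

/-- Open queried edges after a bonus. [folklore] -/
theorem O_hstep_bonus {σ : HState Q} {u : Q} {ans : Bool} : (hstep H r σ (Query.bonus u) ans).O = σ.O := rfl

/-- Attempted vertices after a bonus. [folklore] -/
theorem mem_Y_hstep_bonus {σ : HState Q} {u : Q} {ans : Bool} {y : Q} :
    y ∈ (hstep H r σ (Query.bonus u) ans).Y ↔ y = u ∨ y ∈ σ.Y := by
  simp [hstep]

/-- Query data after a bonus. [folklore] -/
theorem src_hstep_bonus {σ : HState Q} {u : Q} {ans : Bool} : (hstep H r σ (Query.bonus u) ans).src = σ.src := rfl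

/-! ### The halting bound -/

/-- The potential `|Qd| + |Y|` grows by one at every productive step. [folklore] -/
theorem card_hstep {σ : HState Q} {q : Query Q} (h : nq H o r L σ = some q) (a : Bool) :
    (hstep H r σ q a).Qd.card + (hstep H r σ q a).Y.card = σ.Qd.card + σ.Y.card + 1 := by
  cases q with
  | edge a' b' =>
    obtain ⟨-, -, -, hQ⟩ := nq_edge_spec h
    simp [hstep, Finset.card_insert_of_notMem hQ]
    omega
  | bonus u =>
    obtain ⟨-, -, -, hY, -⟩ := nq_bonus_spec h
    simp [hstep, Finset.card_insert_of_notMem hY]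
    omega

/-- Queried edges lie in `E(B_{L+r+1}(o))` and attempted vertices in `B_L(o)`, for every transcript.
[folklore] -/
theorem Qd_subset_Y_subset (hH : H.Connected) (b : List Bool) :
    (stateOf H o r L N b).Qd ⊆ edgesInBallFin H o (L + r + 1) ∧ (stateOf H o r L N b).Y ⊆ ballFin H o L := by
  induction b with
  | nil => simp [stateOf, TExplore.stateOf, machine, HState.init]
  | cons a b ih =>
    cases hq : nq H o r L (stateOf H o r L N b) with
    | none => rw [stateOf_cons_of_none hq]; exact ih
    | some q =>
      rw [stateOf_cons_of_some hq]
      cases q with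
      | edge a' b' =>
        obtain ⟨-, hab, hd, -⟩ := nq_edge_spec hq
        simp only [hstep]
        refine ⟨Finset.insert_subset ?_ ih.1, ih.2⟩
        rw [mem_edgesInBallFin, mk_mem_edgesInBall_iff]
        refine ⟨hab, mem_graphBall_of_dist_le hH (by omega), mem_graphBall_of_dist_le hH ?_⟩
        have := hH.dist_triangle (u := o) (v := a') (w := b')
        rw [SimpleGraph.dist_eq_one_iff_adj.2 hab] at this
        omega
      | bonus u =>
        obtain ⟨-, -, hd, -, -⟩ := nq_bonus_spec hq
        simp only [hstep]
        exact ⟨ih.1, Finset.insert_subset (mem_ballFin.2 (mem_graphBall_of_dist_le hH hd.le)) ih.2⟩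

/-- If the machine has not halted after the transcript `b`, then every step of `b` was productive and
`|b| ≤ |Qd| + |Y|`. [folklore] -/
theorem length_le_of_nq_ne_none (b : List Bool) (h : nq H o r L (stateOf H o r L N b) ≠ none) :
    b.length ≤ (stateOf H o r L N b).Qd.card + (stateOf H o r L N b).Y.card := by
  induction b with
  | nil => simp
  | cons a b ih =>
    cases hq : nq H o r L (stateOf H o r L N b) with
    | none => exact absurd (by rw [stateOf_cons_of_none hq]; exact hq) h
    | some q =>
      rw [stateOf_cons_of_some hq, card_hstep hq, List.length_cons]
      have := ih (by rw [hq]; simp)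
      omega

variable (H o r L) in
/-- The halting time `|E(B_{L+r+1}(o))| + |B_L(o)| + 1`. [cite: MartineauSevero2019, §5 ("after finitely … many iterations")] -/
def haltBound : ℕ := (edgesInBallFin H o (L + r + 1)).card + (ballFin H o L).card + 1

/-- **Halting bound**: after any transcript of length `≥ haltBound` the machine has halted. [cite: MartineauSevero2019, §5] -/
theorem nq_eq_none_of_length (hH : H.Connected) (b : List Bool) (hb : haltBound H o r L ≤ b.length) :
    nq H o r L (stateOf H o r L N b) = none := by
  by_contra h
  have h1 := length_le_of_nq_ne_none b h
  have h2 := Qd_subset_Y_subset (H := H) (o := o) (r := r) (L := L) (N := N) hH b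
  have := Finset.card_le_card h2.1
  have := Finset.card_le_card h2.2
  unfold haltBound at hb
  omega

/-- **The exploration has halted at time `haltBound`** along every run of a good encoding.
[cite: MartineauSevero2019, §5] -/
theorem nq_stateOf_bt_eq_none {W : Type*} {enc : List Bool → Query Q → Finset (Sym2 W)} {Gc : SimpleGraph W}
    (hH : H.Connected) (hE : TExplore.GoodEnc (machine H o r L N) enc Gc) {k : ℕ} (hk : haltBound H o r L ≤ k)
    (ω : BondConfig W) :
    nq H o r L (stateOf H o r L N (TExplore.bt (machine H o r L N) ((TExplore.texpl (machine H o r L N) enc).hist k ω))) = none := by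
  by_contra h
  have hlen := TExplore.length_bt_hist hE k ω h
  exact h (nq_eq_none_of_length hH _ (by rw [hlen]; exact hk))

/-! ### Structural invariants -/

/-- The structural invariants of a replayed state: the root is explored; open edges are queried; a
queried edge is `s(a, b)` for its recorded pair `(a, b) = src e`, an edge of `ℋ` queried from the
explored vertex `a` with `d(o,a) < L + r`; an open queried edge has both endpoints explored; explored
vertices lie in `B_{L+r}(o)`. [cite: MartineauSevero2019, §5 (Conditions maintained at each iteration)] -/
structure Inv (σ : HState Q) : Prop where
  root : o ∈ σ.A
  O_sub : ∀ e ∈ σ.O, e ∈ σ.Qd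
  Qd_src : ∀ e ∈ σ.Qd, e = s((σ.src e).1, (σ.src e).2) ∧ H.Adj (σ.src e).1 (σ.src e).2 ∧
    (σ.src e).1 ∈ σ.A ∧ H.dist o (σ.src e).1 < L + r
  O_ends : ∀ e ∈ σ.O, ∀ v ∈ e, v ∈ σ.A
  A_ball : ∀ v ∈ σ.A, H.dist o v ≤ L + r

/-- **The invariants hold along every transcript.** [cite: MartineauSevero2019, §5] -/
theorem inv_stateOf (hH : H.Connected) (b : List Bool) : Inv (H := H) (o := o) (r := r) (L := L) (stateOf H o r L N b) := by
  induction b with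
  | nil =>
    refine ⟨?_, ?_, ?_, ?_, ?_⟩ <;>
      simp [stateOf, TExplore.stateOf, machine, HState.init]
  | cons ans b ih =>
    cases hq : nq H o r L (stateOf H o r L N b) with
    | none => rw [stateOf_cons_of_none hq]; exact ih
    | some q =>
      rw [stateOf_cons_of_some hq]
      cases q with
      | edge a c =>
        obtain ⟨ha, hac, hd, hQ⟩ := nq_edge_spec hq
        have hAmono : ∀ v ∈ (stateOf H o r L N b).A, v ∈ (hstep H r (stateOf H o r L N b) (Query.edge a c) ans).A :=
          fun v hv => mem_A_hstep_edge.2 (Or.inl hv)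
        refine ⟨hAmono _ ih.root, ?_, ?_, ?_, ?_⟩
        · intro e he
          rw [mem_Qd_hstep_edge]
          rcases mem_O_hstep_edge.1 he with he | ⟨-, rfl⟩
          · exact Or.inr (ih.O_sub e he)
          · exact Or.inl rfl
        · intro e he
          rw [src_hstep_edge]
          rcases mem_Qd_hstep_edge.1 he with rfl | he'
          · rw [Function.update_self]
            exact ⟨rfl, hac, hAmono _ ha, hd⟩
          · have hne : e ≠ s(a, c) := fun h => hQ (h ▸ he')
            rw [Function.update_of_ne hne]
            obtain ⟨h1, h2, h3, h4⟩ := ih.Qd_src e he'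
            exact ⟨h1, h2, hAmono _ h3, h4⟩
        · intro e he v hv
          rcases mem_O_hstep_edge.1 he with he | ⟨hans, rfl⟩
          · exact hAmono _ (ih.O_ends e he v hv)
          · rcases Sym2.mem_iff.1 hv with rfl | rfl
            · exact hAmono _ ha
            · exact mem_A_hstep_edge.2 (Or.inr ⟨hans, rfl⟩)
        · intro v hv
          rcases mem_A_hstep_edge.1 hv with hv | ⟨-, rfl⟩
          · exact ih.A_ball v hv
          · have := hH.dist_triangle (u := o) (v := a) (w := v)
            rw [SimpleGraph.dist_eq_one_iff_adj.2 hac] at this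
            omega
      | bonus u =>
        obtain ⟨-, hu, hd, hY, hopen⟩ := nq_bonus_spec hq
        have hAmono : ∀ v ∈ (stateOf H o r L N b).A, v ∈ (hstep H r (stateOf H o r L N b) (Query.bonus u) ans).A :=
          fun v hv => mem_A_hstep_bonus.2 (Or.inl hv)
        refine ⟨hAmono _ ih.root, ?_, ?_, ?_, ?_⟩
        · intro e he
          rw [Qd_hstep_bonus]
          rw [O_hstep_bonus] at he
          exact ih.O_sub e he
        · intro e he
          rw [Qd_hstep_bonus] at he
          rw [src_hstep_bonus]
          obtain ⟨h1, h2, h3, h4⟩ := ih.Qd_src e he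
          exact ⟨h1, h2, hAmono _ h3, h4⟩
        · intro e he v hv
          rw [O_hstep_bonus] at he
          exact hAmono _ (ih.O_ends e he v hv)
        · intro v hv
          rcases mem_A_hstep_bonus.1 hv with hv | ⟨-, hv⟩
          · exact ih.A_ball v hv
          · rw [sphereF, Finset.mem_filter] at hv
            have := hH.dist_triangle (u := o) (v := u) (w := v)
            omega

/-- Monotonicity of the state along a transcript: `A`, `Qd`, `O`, `Y` only grow, and `src` is frozen
on queried edges. [folklore] -/
theorem mono_cons (ans : Bool) (b : List Bool) :
    (stateOf H o r L N b).A ⊆ (stateOf H o r L N (ans :: b)).A ∧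
    (stateOf H o r L N b).Qd ⊆ (stateOf H o r L N (ans :: b)).Qd ∧
    (stateOf H o r L N b).O ⊆ (stateOf H o r L N (ans :: b)).O ∧
    (stateOf H o r L N b).Y ⊆ (stateOf H o r L N (ans :: b)).Y ∧
    (∀ e ∈ (stateOf H o r L N b).Qd, (stateOf H o r L N (ans :: b)).src e = (stateOf H o r L N b).src e) := by
  cases hq : nq H o r L (stateOf H o r L N b) with
  | none => rw [stateOf_cons_of_none hq]; exact ⟨subset_rfl, subset_rfl, subset_rfl, subset_rfl, fun _ _ => rfl⟩
  | some q =>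
    rw [stateOf_cons_of_some hq]
    cases q with
    | edge a c =>
      obtain ⟨-, -, -, hQ⟩ := nq_edge_spec hq
      refine ⟨fun v hv => mem_A_hstep_edge.2 (Or.inl hv), fun e he => mem_Qd_hstep_edge.2 (Or.inr he),
        fun e he => mem_O_hstep_edge.2 (Or.inl he), fun y hy => by rw [Y_hstep_edge]; exact hy,
        fun e he => ?_⟩
      have hne : e ≠ s(a, c) := fun h => hQ (h ▸ he)
      rw [src_hstep_edge, Function.update_of_ne hne]
    | bonus u =>
      exact ⟨fun v hv => mem_A_hstep_bonus.2 (Or.inl hv), fun e he => by rw [Qd_hstep_bonus]; exact he,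
        fun e he => by rw [O_hstep_bonus]; exact he, fun y hy => mem_Y_hstep_bonus.2 (Or.inr hy),
        fun e _ => by rw [src_hstep_bonus]⟩

/-- Monotonicity along an extension of the transcript (a later transcript `b' ++ b`). [folklore] -/
theorem mono_append (b' b : List Bool) :
    (stateOf H o r L N b).A ⊆ (stateOf H o r L N (b' ++ b)).A ∧
    (stateOf H o r L N b).Qd ⊆ (stateOf H o r L N (b' ++ b)).Qd ∧
    (stateOf H o r L N b).O ⊆ (stateOf H o r L N (b' ++ b)).O ∧
    (stateOf H o r L N b).Y ⊆ (stateOf H o r L N (b' ++ b)).Y ∧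
    (∀ e ∈ (stateOf H o r L N b).Qd, (stateOf H o r L N (b' ++ b)).src e = (stateOf H o r L N b).src e) := by
  induction b' with
  | nil => exact ⟨subset_rfl, subset_rfl, subset_rfl, subset_rfl, fun _ _ => rfl⟩
  | cons a b' ih =>
    obtain ⟨h1, h2, h3, h4, h5⟩ := mono_cons (H := H) (o := o) (r := r) (L := L) (N := N) a (b' ++ b)
    obtain ⟨i1, i2, i3, i4, i5⟩ := ih
    refine ⟨i1.trans h1, i2.trans h2, i3.trans h3, i4.trans h4, fun e he => ?_⟩
    rw [List.cons_append, h5 e (i2 he), i5 e he]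

/-! ### Correctness relative to a pair `(ω, α)` answering the queries -/

section Consistent

variable (ω : Set (Sym2 Q)) (α : Set Q)

/-- The transcript `b` is *consistent* with `(ω, α)`: every recorded answer to an edge query is
"the edge is open in `ω`", and to a bonus query "the vertex is marked in `α`".
[cite: MartineauSevero2019, §5 ("C_∞ … is the cluster of the origin of ((∨_k ω_{e,k})_e, α)")] -/
def Consistent : List Bool → Prop
  | [] => True
  | a :: b => Consistent b ∧
      match nq H o r L (stateOf H o r L N b) with
      | none => True
      | some (Query.edge x y) => (a = true ↔ s(x, y) ∈ ω)
      | some (Query.bonus u) => (a = true ↔ u ∈ α)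

variable {ω α}

/-- **Semantic invariants** of a consistent transcript: a queried edge is recorded open iff it is
open in `ω`; a successful bonus swallowed the sphere; and every explored vertex lies in the enhanced
cluster `𝒞_o(ω, α)`. [cite: MartineauSevero2019, §5 (Conditions ③, ⑤: the explored set is the enhanced cluster)] -/
theorem inv_sem (hH : H.Connected) {b : List Bool}
    (hb : Consistent (H := H) (o := o) (r := r) (L := L) (N := N) ω α b) :
    (∀ e ∈ (stateOf H o r L N b).Qd, (e ∈ (stateOf H o r L N b).O ↔ e ∈ ω)) ∧
    (∀ u ∈ (stateOf H o r L N b).Y, u ∈ α → ballOpen H r (stateOf H o r L N b) u ∧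
      ∀ v ∈ sphereF H u (r + 1), v ∈ (stateOf H o r L N b).A) ∧
    (∀ v ∈ (stateOf H o r L N b).A, v ∈ enhCluster H r {o} ω α) := by
  induction b with
  | nil =>
    refine ⟨by simp [stateOf, TExplore.stateOf, machine, HState.init],
      by simp [stateOf, TExplore.stateOf, machine, HState.init], ?_⟩
    intro v hv
    simp only [stateOf, TExplore.stateOf, machine, HState.init, Finset.mem_singleton] at hv
    subst hv
    exact subset_enhCluster H r {v} ω α rfl
  | cons ans b ih =>
    obtain ⟨hb, hans⟩ := hb
    obtain ⟨ihO, ihY, ihA⟩ := ih hb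
    have hinv := inv_stateOf (H := H) (o := o) (r := r) (L := L) (N := N) hH b
    cases hq : nq H o r L (stateOf H o r L N b) with
    | none => rw [stateOf_cons_of_none hq]; exact ⟨ihO, ihY, ihA⟩
    | some q =>
      rw [hq] at hans
      rw [stateOf_cons_of_some hq]
      obtain ⟨mA, mQd, mO, mY, msrc⟩ := mono_cons (H := H) (o := o) (r := r) (L := L) (N := N) ans b
      rw [stateOf_cons_of_some hq] at mA mQd mO mY
      cases q with
      | edge a c =>
        simp only at hans
        obtain ⟨ha, hac, hd, hQ⟩ := nq_edge_spec hq
        refine ⟨?_, ?_, ?_⟩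
        · intro e he
          rw [mem_O_hstep_edge]
          rcases mem_Qd_hstep_edge.1 he with rfl | he
          · constructor
            · rintro (h | ⟨h, -⟩)
              · exact absurd (hinv.O_sub _ h) hQ
              · exact hans.1 h
            · intro h
              exact Or.inr ⟨hans.2 h, rfl⟩
          · have hne : e ≠ s(a, c) := fun h => hQ (h ▸ he)
            constructor
            · rintro (h | ⟨-, h⟩)
              · exact (ihO e he).1 h
              · exact absurd h hne
            · intro h
              exact Or.inl ((ihO e he).2 h)
        · intro u hu huα
          rw [Y_hstep_edge] at hu
          obtain ⟨hopen, hsph⟩ := ihY u hu huα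
          exact ⟨fun e he => mO (hopen e he), fun v hv => mA (hsph v hv)⟩
        · intro v hv
          rcases mem_A_hstep_edge.1 hv with hv | ⟨h, rfl⟩
          · exact ihA v hv
          · exact mem_enhCluster_of_adj (ihA a ha) hac (hans.1 h)
      | bonus u =>
        simp only at hans
        obtain ⟨-, hu, hd, hY, hopen⟩ := nq_bonus_spec hq
        refine ⟨?_, ?_, ?_⟩
        · intro e he
          rw [O_hstep_bonus]
          rw [Qd_hstep_bonus] at he
          exact ihO e he
        · intro u' hu' hu'α
          rcases mem_Y_hstep_bonus.1 hu' with rfl | hu'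
          · refine ⟨fun e he => mO (hopen e he), fun v hv => ?_⟩
            exact mem_A_hstep_bonus.2 (Or.inr ⟨hans.2 hu'α, hv⟩)
          · obtain ⟨hopen', hsph⟩ := ihY u' hu' hu'α
            exact ⟨fun e he => mO (hopen' e he), fun v hv => mA (hsph v hv)⟩
        · intro v hv
          rcases mem_A_hstep_bonus.1 hv with hv | ⟨h, hv⟩
          · exact ihA v hv
          · rw [sphereF, Finset.mem_filter] at hv
            refine mem_enhCluster_of_bonus (ihA u hu) (hans.1 h) (fun e he => ?_) hv.2
            have he' : e ∈ edgesInBallFin H u r := mem_edgesInBallFin.2 he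
            exact (ihO e (hinv.O_sub e (hopen e he'))).1 (hopen e he')

/-- The transcript event: an explored vertex at distance `≥ L` from the root. [cite: MartineauSevero2019, §6 (𝓔_L)] -/
def ReachState (H : SimpleGraph Q) (o : Q) (L : ℕ) (σ : HState Q) : Prop := ∃ v ∈ σ.A, L ≤ H.dist o v

/-- **Exploration correctness.** For a consistent transcript after which the machine has halted, "an
explored vertex at distance `≥ L`" holds iff `(ω, α) ∈ 𝓔_L`. (⇒: explored vertices lie in the enhanced
cluster. ⇐: the halted explored set contains `o` and is closed under the two rules at vertices of
`B_{L-1}(o)` — an unqueried open edge or an un-attempted fully open ball would be a live query — so the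
closure principle `exists_far_of_closed` applies.) [cite: MartineauSevero2019, §5 (Step ∞: "C_∞ has the distribution of the cluster of the origin for the (p,s)-process on ℋ")] -/
theorem reachState_iff_of_halted (hH : H.Connected) {b : List Bool}
    (hb : Consistent (H := H) (o := o) (r := r) (L := L) (N := N) ω α b)
    (hhalt : nq H o r L (stateOf H o r L N b) = none) :
    ReachState H o L (stateOf H o r L N b) ↔ ∃ v, v ∈ enhCluster H r {o} ω α ∧ L ≤ H.dist o v := by
  obtain ⟨hO, hY, hA⟩ := inv_sem (H := H) (o := o) (r := r) (L := L) (N := N) hH hb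
  have hinv := inv_stateOf (H := H) (o := o) (r := r) (L := L) (N := N) hH b
  obtain ⟨hedges, hbonus⟩ := nq_eq_none_iff.1 hhalt
  set σ := stateOf H o r L N b with hσ
  constructor
  · rintro ⟨v, hv, hvL⟩
    exact ⟨v, hA v hv, hvL⟩
  · intro hfar
    have hclosedE : ∀ u w, u ∈ (↑σ.A : Set Q) → H.dist o u < L → H.Adj u w → s(u, w) ∈ ω → w ∈ (↑σ.A : Set Q) := by
      intro u w hu hud hadj he
      have hQd : s(u, w) ∈ σ.Qd := hedges u (Finset.mem_coe.1 hu) w hadj (by omega)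
      have hOe : s(u, w) ∈ σ.O := (hO _ hQd).2 he
      exact Finset.mem_coe.2 (hinv.O_ends _ hOe w (Sym2.mem_mk_right u w))
    have hclosedB : ∀ u w, u ∈ (↑σ.A : Set Q) → H.dist o u < L → u ∈ α → edgesInBall H u r ⊆ ω →
        H.dist u w = r + 1 → w ∈ (↑σ.A : Set Q) := by
      intro u w hu hud huα hball hdist
      have hu' : u ∈ σ.A := Finset.mem_coe.1 hu
      -- the ball `B_r(u)` is explored and all its edges are queried-open
      have hballA : ∀ k, k ≤ r → ∀ z ∈ graphBall H u k, z ∈ σ.A ∧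
          ∀ z', H.Adj z z' → z' ∈ graphBall H u k → s(z, z') ∈ σ.O := by
        intro k hk
        induction k with
        | zero =>
          intro z hz
          rw [graphBall_zero, Set.mem_singleton_iff] at hz
          subst hz
          refine ⟨hu', fun z' hzz' hz' => ?_⟩
          rw [graphBall_zero, Set.mem_singleton_iff] at hz'
          subst hz'
          exact absurd hzz' (SimpleGraph.irrefl _)
        | succ k ih =>
          intro z hz
          have ih' := ih (Nat.le_of_succ_le hk)
          -- `z` is explored: `z = u` or a neighbour of a point of `B_k(u)` through an open ball edge
          have hzA : z ∈ σ.A := by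
            rcases (mem_graphBall_succ_iff' H u z k).1 hz with rfl | ⟨z₀, hz₀, hadj⟩
            · exact hu'
            · obtain ⟨hz₀A, -⟩ := ih' z₀ hz₀
              have hd₀ : H.dist o z₀ < L + r := by
                have h1 := dist_le_of_mem_graphBall hz₀
                have := hH.dist_triangle (u := o) (v := u) (w := z₀)
                omega
              have hQd : s(z₀, z) ∈ σ.Qd := hedges z₀ hz₀A z hadj hd₀
              have heω : s(z₀, z) ∈ ω := hball ⟨hadj, graphBall_mono H u (by omega) hz₀, graphBall_mono H u hk hz⟩
              exact hinv.O_ends _ ((hO _ hQd).2 heω) z (Sym2.mem_mk_right _ _)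
          refine ⟨hzA, fun z' hzz' hz' => ?_⟩
          have hdz : H.dist o z < L + r := by
            have h1 := dist_le_of_mem_graphBall hz
            have := hH.dist_triangle (u := o) (v := u) (w := z)
            omega
          have hQd : s(z, z') ∈ σ.Qd := hedges z hzA z' hzz' hdz
          exact (hO _ hQd).2 (hball ⟨hzz', graphBall_mono H u hk hz, graphBall_mono H u hk hz'⟩)
      have hopen : ballOpen H r σ u := by
        intro e he
        rw [mem_edgesInBallFin] at he
        induction e using Sym2.inductionOn with
        | hf z z' =>
          obtain ⟨hzz', hz, hz'⟩ := mk_mem_edgesInBall_iff.1 he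
          exact ((hballA r le_rfl z hz).2 z' hzz' hz')
      have huY : u ∈ σ.Y := hbonus u hu' hud hopen
      have hsph := (hY u huY huα).2
      refine Finset.mem_coe.2 (hsph w ?_)
      rw [sphereF, Finset.mem_filter, mem_ballFin]
      exact ⟨mem_graphBall_of_dist_le hH hdist.le, hdist⟩
    obtain ⟨v, hv, hvL⟩ := exists_far_of_closed (↑σ.A : Set Q) (Finset.mem_coe.2 hinv.root) hclosedE hclosedB hfar
    exact ⟨v, Finset.mem_coe.1 hv, hvL⟩

end Consistent

end Coupling

end Literature.Probability.Percolation
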